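import Mathlib
import Summits.Ventures.DiscreteObjects.Mahler.CensusKernelDeg16P001
import Summits.Ventures.DiscreteObjects.Mahler.CensusKernelDeg16P002
import Summits.Ventures.DiscreteObjects.Mahler.CensusKernelDeg16P003
import Summits.Ventures.DiscreteObjects.Mahler.CensusKernelDeg16P004
import Summits.Ventures.DiscreteObjects.Mahler.CensusKernelDeg16P005
import Summits.Ventures.DiscreteObjects.Mahler.CensusKernelDeg16P006
import Summits.Ventures.DiscreteObjects.Mahler.CensusKernelDeg16P007
import Summits.Ventures.DiscreteObjects.Mahler.CensusKernelDeg16P008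
import Summits.Ventures.DiscreteObjects.Mahler.CensusKernelDeg16P009
import Summits.Ventures.DiscreteObjects.Mahler.CensusKernelDeg16P010
import Summits.Ventures.DiscreteObjects.Mahler.CensusKernelDeg16P011
import Summits.Ventures.DiscreteObjects.Mahler.CensusKernelDeg16P012
import Summits.Ventures.DiscreteObjects.Mahler.CensusKernelDeg16P013
import Summits.Ventures.DiscreteObjects.Mahler.CensusKernelDeg16P014
import Summits.Ventures.DiscreteObjects.Mahler.CensusKernelDeg16P015
import Summits.Ventures.DiscreteObjects.Mahler.CensusKernelDeg16P016
import Summits.Ventures.DiscreteObjects.Mahler.CensusKernelDeg16P017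
import Summits.Ventures.DiscreteObjects.Mahler.CensusKernelDeg16P018
import Summits.Ventures.DiscreteObjects.Mahler.CensusKernelDeg16P019
import Summits.Ventures.DiscreteObjects.Mahler.CensusKernelDeg16P020
import Summits.Ventures.DiscreteObjects.Mahler.CensusKernelDeg16P021
import Summits.Ventures.DiscreteObjects.Mahler.CensusKernelDeg16P022
import Summits.Ventures.DiscreteObjects.Mahler.CensusKernelDeg16P023
import Summits.Ventures.DiscreteObjects.Mahler.CensusKernelDeg16P024
import Summits.Ventures.DiscreteObjects.Mahler.CensusKernelDeg16P025
import Summits.Ventures.DiscreteObjects.Mahler.CensusKernelDeg16P026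
import Summits.Ventures.DiscreteObjects.Mahler.CensusKernelDeg16P027
import Summits.Ventures.DiscreteObjects.Mahler.CensusKernelDeg16P028
import Summits.Ventures.DiscreteObjects.Mahler.CensusKernelDeg16P029
import Summits.Ventures.DiscreteObjects.Mahler.CensusKernelDeg16P030
import Summits.Ventures.DiscreteObjects.Mahler.CensusKernelDeg16P031
import Summits.Ventures.DiscreteObjects.Mahler.CensusKernelDeg16P032
import Summits.Ventures.DiscreteObjects.Mahler.CensusKernelDeg16P033
import Summits.Ventures.DiscreteObjects.Mahler.CensusKernelDeg16P034
import Summits.Ventures.DiscreteObjects.Mahler.CensusKernelDeg16P035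
import Summits.Ventures.DiscreteObjects.Mahler.CensusKernelDeg16P036
import Summits.Ventures.DiscreteObjects.Mahler.CensusKernelDeg16P037
import Summits.Ventures.DiscreteObjects.Mahler.CensusKernelDeg16P038
import Summits.Ventures.DiscreteObjects.Mahler.CensusKernelDeg16P039
import Summits.Ventures.DiscreteObjects.Mahler.CensusKernelDeg16P040
import Summits.Ventures.DiscreteObjects.Mahler.CensusKernelDeg16P041
import Summits.Ventures.DiscreteObjects.Mahler.CensusKernelDeg16P042
import Summits.Ventures.DiscreteObjects.Mahler.CensusKernelDeg16P043
import Summits.Ventures.DiscreteObjects.Mahler.CensusKernelDeg16P044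
import Summits.Ventures.DiscreteObjects.Mahler.CensusKernelDeg16P045
import Summits.Ventures.DiscreteObjects.Mahler.CensusKernelDeg16P046
import Summits.Ventures.DiscreteObjects.Mahler.CensusKernelDeg16P047
import Summits.Ventures.DiscreteObjects.Mahler.CensusKernelDeg16P048
import Summits.Ventures.DiscreteObjects.Mahler.CensusKernelDeg16P049
import Summits.Ventures.DiscreteObjects.Mahler.CensusKernelDeg16P050
import Summits.Ventures.DiscreteObjects.Mahler.CensusKernelDeg16P051
import Summits.Ventures.DiscreteObjects.Mahler.CensusKernelDeg16P052
import Summits.Ventures.DiscreteObjects.Mahler.CensusKernelDeg16P053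
import Summits.Ventures.DiscreteObjects.Mahler.CensusKernelDeg16P054
import Summits.Ventures.DiscreteObjects.Mahler.CensusKernelDeg16P055
import Summits.Ventures.DiscreteObjects.Mahler.CensusKernelDeg16P056
import Summits.Ventures.DiscreteObjects.Mahler.CensusKernelDeg16P057
import Summits.Ventures.DiscreteObjects.Mahler.CensusKernelDeg16P058
import Summits.Ventures.DiscreteObjects.Mahler.CensusKernelDeg16P059
import Summits.Ventures.DiscreteObjects.Mahler.CensusKernelDeg16P060
import Summits.Ventures.DiscreteObjects.Mahler.CensusKernelDeg16P061
import Summits.Ventures.DiscreteObjects.Mahler.CensusKernelDeg16P062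
import Summits.Ventures.DiscreteObjects.Mahler.CensusKernelDeg16P063
import Summits.Ventures.DiscreteObjects.Mahler.CensusKernelDeg16P064
import Summits.Ventures.DiscreteObjects.Mahler.CensusKernelDeg16P065
import Summits.Ventures.DiscreteObjects.Mahler.CensusKernelDeg16P066
import Summits.Ventures.DiscreteObjects.Mahler.CensusKernelDeg16P067
import Summits.Ventures.DiscreteObjects.Mahler.CensusKernelDeg16P068
import Summits.Ventures.DiscreteObjects.Mahler.CensusKernelDeg16P069
import Summits.Ventures.DiscreteObjects.Mahler.CensusKernelDeg16P070
import Summits.Ventures.DiscreteObjects.Mahler.CensusKernelDeg16P071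
import Summits.Ventures.DiscreteObjects.Mahler.CensusKernelDeg16P072
import Summits.Ventures.DiscreteObjects.Mahler.CensusKernelDeg16P073
import Summits.Ventures.DiscreteObjects.Mahler.CensusKernelDeg16P074
import Summits.Ventures.DiscreteObjects.Mahler.CensusKernelDeg16P075
import Summits.Ventures.DiscreteObjects.Mahler.CensusKernelDeg16P076
import Summits.Ventures.DiscreteObjects.Mahler.CensusKernelDeg16P077
import Summits.Ventures.DiscreteObjects.Mahler.CensusKernelDeg16P078
import Summits.Ventures.DiscreteObjects.Mahler.CensusKernelDeg16P079
import Summits.Ventures.DiscreteObjects.Mahler.CensusKernelDeg16P080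
import Summits.Ventures.DiscreteObjects.Mahler.CensusKernelDeg16P081
import Summits.Ventures.DiscreteObjects.Mahler.CensusKernelDeg16P082
import Summits.Ventures.DiscreteObjects.Mahler.CensusKernelDeg16P083
import Summits.Ventures.DiscreteObjects.Mahler.CensusKernelDeg16P084
import Summits.Ventures.DiscreteObjects.Mahler.CensusKernelDeg16P085
import Summits.Ventures.DiscreteObjects.Mahler.CensusKernelDeg16P086
import Summits.Ventures.DiscreteObjects.Mahler.CensusKernelDeg16P087
import Summits.Ventures.DiscreteObjects.Mahler.CensusKernelDeg16P088
import Summits.Ventures.DiscreteObjects.Mahler.CensusKernelDeg16P089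
import Summits.Ventures.DiscreteObjects.Mahler.CensusKernelDeg16P090
import Summits.Ventures.DiscreteObjects.Mahler.CensusKernelDeg16P091
import Summits.Ventures.DiscreteObjects.Mahler.CensusKernelDeg16P092
import Summits.Ventures.DiscreteObjects.Mahler.CensusKernelDeg16P093
import Summits.Ventures.DiscreteObjects.Mahler.CensusKernelDeg16P094
import Summits.Ventures.DiscreteObjects.Mahler.CensusKernelDeg16P095
import Summits.Ventures.DiscreteObjects.Mahler.CensusKernelDeg16P096
import Summits.Ventures.DiscreteObjects.Mahler.CensusKernelDeg16P097
import Summits.Ventures.DiscreteObjects.Mahler.CensusKernelDeg16P098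
import Summits.Ventures.DiscreteObjects.Mahler.CensusKernelDeg16P099
import Summits.Ventures.DiscreteObjects.Mahler.CensusKernelDeg16P100

/-!
# Kernel census, degree 16 (part NL3): node lemmas (3/3) for the nodes `(c₁,c₂)` whose kernel checks span several parts

Cell `pub-namedobj`, seat `pub-namedobj-mahler-g13`. Framing: lottery ticket; floor = certified bounds/negative ranges.

Part of the kernel proof of `DegreeCensus 16 (13/10) coresDeg16` (see part A for the method: census search with
Fejér–Riesz cuts, `CensusSearchCuts`; 1204796 leaves with `c₁ ≥ 0`, 19245 certified survivors). This part re-assembles, by `interval_cases` on `c₃`, the node lemmas of the nodes `(c₁, c₂)` whose per-`c₃` kernel checks live in the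
chunk parts (it imports all of them). CONTROL/replication of the published degree-16 list
(Boyd 1980; Mossinghoff 1998; Mossinghoff–Rhin–Wu 2008), not new ground.
-/

namespace Summit.Ventures.DiscreteObjects.Mahler

open Polynomial

/-- Every survivor below the node `[5, 13]` carries a valid certificate (by cases on the next coefficient). -/
theorem certified16n_p5_p13 : ∀ a ∈ censusSearchC T16 CT16 6 [5, 13] (psumsRev [5, 13] 2),
    ∃ c, checkCert 13 10 16 coresDeg16 (1 :: palC a) c = true := by
  intro a ha
  rw [mem_censusSearchC_node_iff (pre := [5, 13]) (n := 2) rfl, (by decide +kernel : nodeLoC T16 CT16 [5, 13] (psumsRev [5, 13] 2) = 18), (by decide +kernel : nodeHiC T16 CT16 [5, 13] (psumsRev [5, 13] 2) = 27)] at ha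
  obtain ⟨ak, hak, ha⟩ := ha
  simp only [List.cons_append, List.nil_append, Nat.reduceAdd] at ha
  rw [mem_icc] at hak
  obtain ⟨hlo, hhi⟩ := hak
  interval_cases ak
  · exact exists_cert_of_allCertified _ _ certified16_p5_p13_p18 a ha
  · exact exists_cert_of_allCertified _ _ certified16_p5_p13_p19 a ha
  · exact exists_cert_of_allCertified _ _ certified16_p5_p13_p20 a ha
  · exact certified16n_p5_p13_p21 a ha
  · exact certified16n_p5_p13_p22 a ha
  · exact certified16n_p5_p13_p23 a ha
  · exact certified16n_p5_p13_p24 a ha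
  · exact certified16n_p5_p13_p25 a ha
  · exact exists_cert_of_allCertified _ _ certified16_p5_p13_p26 a ha
  · exact exists_cert_of_allCertified _ _ certified16_p5_p13_p27 a ha

end Summit.Ventures.DiscreteObjects.Mahler
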